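import Summits.Ventures.CertifiedManyBodySolver.Downfold.TperpSeam
import Literature.MathematicalPhysics.QuantumLattice.SingleDirectionHoppingKinematicRow
import HarnessLib

/-!
# The interlayer seam with the SHARP kinematic constant: floor inflation `(4/π)·Σ_b|t_z,b|` instead of `2·Σ_b|t_z,b|`

Venture CertifiedManyBodySolver, stage S1 → S2 seam; the `4/π` twin of `TperpSeam.lean` (hubbard-box-p1 g4, consumed by
downfold mod-1's `TperpSeamWords.lean`). The kernel input is `Literature/…/SingleDirectionHoppingKinematicRow.lean` (hubbard-box-p1
g5): for every translation-invariant state of the lattice fermions and every lattice vector `v ≠ 0` the bond energy obeys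
`|e_{Φ_v^t}(ω)| ≤ (4/π)|t|` (the free Fermi chain), hence the dimension-raising window of a uniformly stacked one-band crystal is
`[e_ρ − (4/π)Σ_b|t_{z,b}|, e_ρ]` (`tiGroundEnergyDensityAt_layeredHubbardTTPrime_mem_Icc_sharp`). Same hypotheses and shapes as
the parent; only the floor inflation changes: `2·mZ ↦ (4/π)·mZ` (`mZ = max |eZ.lo| |eZ.hi|`; `4/π ≈ 1.2733`).

* `holdsOn_layeredHubbardTTPrime_of_window_sharp` — every interlayer pattern `w_b` (`(w_b)₀ ≠ 0`, range box `R' ≥ 1`) with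
  `Σ_b |tz_b| ≤ |p tperp/t|`: on `B`, `L − (4/π)·mZ ≤ e_{p n}(layered crystal) ≤ R`.
* `holdsOn_verticalHubbardTTPrime_of_window_sharp` — simple tetragonal stacking: `[L − (4/π)·mZ, R]`.

Everything here is PROVED. HONEST FRAMING: as in the parent — energy words for TRANSLATION-INVARIANT fixed-filling ground states of the
uniformly stacked crystal (the bilayer / periodic stackings keep the norm constant `2` per inequivalent bond class: a periodic state
can dimerise a bond class); a downfolded box is a modelling claim (`B.Mem p`); nothing here is a phase word or a material number.
-/

namespace Summit.Ventures.CertifiedManyBodySolver.Downfold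

open NonemptyInterval Literature.MathematicalPhysics.QuantumLattice
  Literature.MathematicalPhysics.QuantumLattice.ThermodynamicLimit Literature.Probability.LatticeModels

/-- **THE INTERLAYER SEAM WITH THE SHARP CONSTANT, every interlayer pattern**: hypotheses as in
`holdsOn_layeredHubbardTTPrime_of_window`; conclusion with floor inflation `(4/π)·max(|eZ.lo|,|eZ.hi|)`. [folklore] -/
theorem holdsOn_layeredHubbardTTPrime_of_window_sharp {B : OneBandBox} {eU eS eN eZ : Entry}
    (hU : B .UOverT = some eU) (hS : B .tpOverT = some eS) (hN : B .filling = some eN)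
    (hZ : B .tperpOverT = some eZ) (hU0 : 0 ≤ eU.encl.fst) (hN0 : 0 < eN.encl.fst) (hN2 : eN.encl.snd < 2)
    {L R : ℝ}
    (hE : ∀ θ ∈ Set.Icc (s2Lo eU eS eN) (s2Hi eU eS eN),
      L ≤ energyDensityTT' 1 (θ 1) (θ 0) (θ 2) ∧ energyDensityTT' 1 (θ 1) (θ 0) (θ 2) ≤ R)
    {κ : Type*} [Fintype κ] {w : κ → Site 3} (hw : ∀ b, w b 0 ≠ 0) {R' : ℝ} (hR' : 1 ≤ R')
    (hwR' : ∀ b, w b ∈ thicken ({0} : Finset (Site 3)) R') :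
    HoldsOn (fun p : OneBandCoord → ℝ => ∀ tz : κ → ℝ, ∑ b, |tz b| ≤ |p .tperpOverT| →
      L - 4 / Real.pi * ((max |eZ.encl.fst| |eZ.encl.snd| : ℚ) : ℝ) ≤
          (layeredHubbardTTPrime 1 (p .tpOverT) (p .UOverT) w tz).tiGroundEnergyDensityAt R' (p .filling) ∧
        (layeredHubbardTTPrime 1 (p .tpOverT) (p .UOverT) w tz).tiGroundEnergyDensityAt R' (p .filling) ≤ R) B := by
  intro p hp tz htz
  obtain ⟨hu0, hn0, hn2⟩ := mem_sideConditions hU hN hU0 hN0 hN2 hp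
  have hθ := window_of_mem hU hS hN hE hp
  have hm : |p .tperpOverT| ≤ ((max |eZ.encl.fst| |eZ.encl.snd| : ℚ) : ℝ) := Entry.abs_le_of_mem (hp _ _ hZ)
  have h := tiGroundEnergyDensityAt_layeredHubbardTTPrime_mem_Icc_sharp 1 (p .tpOverT) hu0 hn0 hn2 hw tz hR' hwR'
  have hπ : 0 ≤ 4 / Real.pi := by positivity
  have h4 : 4 / Real.pi * ∑ b, |tz b| ≤ 4 / Real.pi * ((max |eZ.encl.fst| |eZ.encl.snd| : ℚ) : ℝ) :=
    mul_le_mul_of_nonneg_left (htz.trans hm) hπ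
  exact ⟨by linarith [h.1, hθ.1], h.2.trans hθ.2⟩

/-- **THE INTERLAYER SEAM WITH THE SHARP CONSTANT, simple tetragonal stacking** (one vertical bond of amplitude `p tperp/t`):
on `B`, `L − (4/π)·max(|eZ.lo|,|eZ.hi|) ≤ e_{p n}(vertical crystal) ≤ R`. [folklore] -/
theorem holdsOn_verticalHubbardTTPrime_of_window_sharp {B : OneBandBox} {eU eS eN eZ : Entry}
    (hU : B .UOverT = some eU) (hS : B .tpOverT = some eS) (hN : B .filling = some eN)
    (hZ : B .tperpOverT = some eZ) (hU0 : 0 ≤ eU.encl.fst) (hN0 : 0 < eN.encl.fst) (hN2 : eN.encl.snd < 2)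
    {L R : ℝ}
    (hE : ∀ θ ∈ Set.Icc (s2Lo eU eS eN) (s2Hi eU eS eN),
      L ≤ energyDensityTT' 1 (θ 1) (θ 0) (θ 2) ∧ energyDensityTT' 1 (θ 1) (θ 0) (θ 2) ≤ R) :
    HoldsOn (fun p : OneBandCoord → ℝ =>
      L - 4 / Real.pi * ((max |eZ.encl.fst| |eZ.encl.snd| : ℚ) : ℝ) ≤
          (layeredHubbardTTPrime 1 (p .tpOverT) (p .UOverT) (fun _ : Fin 1 => (unitVec (0 : Fin 3) : Site 3))
            (fun _ => p .tperpOverT)).tiGroundEnergyDensityAt 1 (p .filling) ∧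
        (layeredHubbardTTPrime 1 (p .tpOverT) (p .UOverT) (fun _ : Fin 1 => (unitVec (0 : Fin 3) : Site 3))
            (fun _ => p .tperpOverT)).tiGroundEnergyDensityAt 1 (p .filling) ≤ R) B := by
  intro p hp
  have h := holdsOn_layeredHubbardTTPrime_of_window_sharp hU hS hN hZ hU0 hN0 hN2 hE
    (w := fun _ : Fin 1 => (unitVec (0 : Fin 3) : Site 3)) (fun _ => unitVec_zero_vertical.1) le_rfl
    (fun _ => unitVec_zero_vertical.2) p hp (fun _ => p .tperpOverT) (by simp)
  exact h

end Summit.Ventures.CertifiedManyBodySolver.Downfold
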